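import Mathlib
import HarnessLib
import Summits.AtomisticToContinuum.FouriersLaw.Theses.JunctionLocality
import Summits.AtomisticToContinuum.FouriersLaw.Theorems.JunctionLocalitySuperadditiveResistanceStubInsertionIdentity
import Summits.AtomisticToContinuum.FouriersLaw.Theorems.JunctionLocalitySuperadditiveResistanceRoughnessFloorPairing

/-!
# Helper `helper_roughnessFloor` of line `thermalise-then-cut-probe-insertion` (crux stmt-AtomisticToContinuum-11748) — part II: orthogonality and the floor

The registered helper `helper_roughnessFloor` — tightness, in order, of the lead's stub
`stub_junctionRoughnessLTE`: for the plain `(N+M)`-chain's first-order NESS density `h`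
(`PlainFrame P T (N+M) h G`) and EVERY probe temperature `θ`,

  `G² ≤ (∫ ĵ² dμ_T) · roughness P T N M (h − θ e_K)`,  `ĵ = p_{N−1} V'(q_N − q_{N−1})`, `V'(r) = r + βr³`.

From part I (`…RoughnessFloorPairing.lean`: `∫ ĵ h dμ_T = −G`) and, proved here:
`floor_integral_snd_mul_eq_zero` — first-order Gaussian integration by parts in one momentum against
a `p_j`-independent weight (`∫ p_j F dμ_T = 0`, Mathlib's integration by parts for integrable
products, no regularity of `F`); hence `ĵ ⟂ range Π_K` (`floor_integral_jhat_mul_condK`: the redraw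
`Π_K f` and `V'(r_J)` do not see `p_{N−1}`, which enters `ĵ` linearly); `ĵ ⟂ e_K` by momentum
reversal (`floor_integral_jhat_mul_eK`); so `−G = ∫ ĵ · (I − Π_K)(h − θe_K) dμ_T` and Cauchy–Schwarz
gives the floor. All folklore; no definitions; nothing is taken as a named fact.
-/

noncomputable section

open MeasureTheory Filter Topology ProbabilityTheory
open scoped ContDiff NNReal ENNReal
open Literature.MathematicalPhysics.KineticTheory.HeatConduction

namespace Summit.AtomisticToContinuum.FouriersLaw.Cruxes.SuperadditiveResistance.ThermaliseThenCutProbeInsertion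

open InsertionToolbox InsertionToolbox.Assembly
open Summit.AtomisticToContinuum.FouriersLaw.Theorems.SuperadditiveResistance.TerminationLocality
  (memLp_comp_restrictLeft)
open FloatingProbeBypassLaplacian (integral_mul_sq_sub_gibbsMeasure integral_comp_restrictLeft_mul_sq_sub
  pinnedChain_integral_snd_sq pinnedChain_memLp_two_snd integrable_mul_gibbsDensity_of_integrable
  hasLineDerivAt_zero_of_forall_add_smul)

section Floor

variable {ω₂ lam β : ℝ} {N M : ℕ}

/-! ### `V'(r_J) ∈ L²(μ_T)` -/

/-- `V'(q_N − q_{N−1}) ∈ L²(μ_T)` (`V'(r) = r + βr³`; the junction Boltzmann factor tames it). -/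
theorem floor_memLp_junctionForce (hω : 0 < ω₂) (hl : 0 ≤ lam) (hb : 0 ≤ β) (γ : ℝ) (hN : 1 ≤ N)
    (hM : 1 ≤ M) {T : ℝ} (hT : 0 < T) :
    MemLp (fun x : PhaseSpace (N + M) =>
        (x.1 ⟨N, by omega⟩ - x.1 ⟨N - 1, by omega⟩) +
          β * (x.1 ⟨N, by omega⟩ - x.1 ⟨N - 1, by omega⟩) ^ 3)
      2 ((pinnedChain ω₂ lam β γ).gibbsMeasure (N + M) T) := by
  haveI := pinnedChain_isProbabilityMeasure_gibbsMeasure hω hl hb γ N hT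
  have h := memLp_junctionForce_mul_comp_restrictLeft hω hl hb γ hN hM hT (M := M)
    (Φ := fun _ : PhaseSpace N => (1 : ℝ)) continuous_const (memLp_const 1)
  refine (memLp_congr_ae (ae_of_all _ fun x => ?_)).mp h
  simp only [mul_one]

/-! ### First-order Gaussian integration by parts against a `p_j`-independent weight -/

/-- For the pinned chain (`T > 0`) and `F ∈ L¹(μ_T)` with `p_j F ∈ L¹(μ_T)` and `F` constant along
the `p_j`-lines: `∫ p_j F dμ_T = 0` (`p_j e^{-H/T} = −T ∂_{p_j} e^{-H/T}`; Mathlib's integration by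
parts for integrable products; no regularity of `F`). -/
theorem floor_integral_snd_mul_eq_zero (hω : 0 < ω₂) (hl : 0 ≤ lam) (hb : 0 ≤ β) (γ : ℝ) (L : ℕ)
    {T : ℝ} (hT : 0 < T) (j : Fin L) {F : PhaseSpace L → ℝ}
    (hF : ∀ (x : PhaseSpace L) (t : ℝ), F (x + t • ((0, Pi.single j 1) : PhaseSpace L)) = F x)
    (h0 : Integrable F ((pinnedChain ω₂ lam β γ).gibbsMeasure L T))
    (h1 : Integrable (fun x => x.2 j * F x) ((pinnedChain ω₂ lam β γ).gibbsMeasure L T)) :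
    ∫ x, x.2 j * F x ∂((pinnedChain ω₂ lam β γ).gibbsMeasure L T) = 0 := by
  haveI := isAddHaarMeasure_volume_phaseSpace L
  have h0' := integrable_mul_gibbsDensity_of_integrable hω hl hb γ L hT h0
  have h1' := integrable_mul_gibbsDensity_of_integrable hω hl hb γ L hT h1
  have e := integral_bilinear_hasLineDerivAt_right_eq_neg_left_of_integrable
    (μ := (volume : Measure (PhaseSpace L))) (B := ContinuousLinearMap.mul ℝ ℝ)
    (f := F) (f' := fun _ => (0 : ℝ)) (g := (pinnedChain ω₂ lam β γ).gibbsDensity L T)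
    (g' := fun x => -(x.2 j / T) * (pinnedChain ω₂ lam β γ).gibbsDensity L T x)
    (v := ((0, Pi.single j 1) : PhaseSpace L)) ?_ ?_ ?_
    (fun x _ => hasLineDerivAt_zero_of_forall_add_smul j hF x)
    (fun x _ => (pinnedChain ω₂ lam β γ).hasLineDerivAt_gibbsDensity
      ((pinnedChain ω₂ lam β γ).hasLineDerivAt_hamiltonian_unitP L x j))
  · simp only [ContinuousLinearMap.mul_apply', zero_mul, integral_zero, neg_zero] at e
    have e2 : ∫ x, F x * (-(x.2 j / T) * (pinnedChain ω₂ lam β γ).gibbsDensity L T x) =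
        (-T⁻¹) * ∫ x, x.2 j * F x * (pinnedChain ω₂ lam β γ).gibbsDensity L T x := by
      rw [← integral_const_mul]
      exact integral_congr_ae (ae_of_all _ fun x => by simp only [div_eq_mul_inv]; ring)
    rw [e2] at e
    have hT0 : (-T⁻¹) ≠ 0 := neg_ne_zero.mpr (inv_ne_zero hT.ne')
    have e3 : ∫ x, x.2 j * F x * (pinnedChain ω₂ lam β γ).gibbsDensity L T x = 0 := by
      rcases mul_eq_zero.mp e with h | h
      · exact absurd h hT0
      · exact h
    rw [OscillatorChain.integral_gibbsMeasure, e3, mul_zero]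
  · simp only [ContinuousLinearMap.mul_apply', zero_mul]
    exact integrable_zero _ _ _
  · simp only [ContinuousLinearMap.mul_apply']
    have h2 : Integrable (fun x => (-T⁻¹) *
        (x.2 j * F x * (pinnedChain ω₂ lam β γ).gibbsDensity L T x)) := h1'.const_mul _
    refine h2.congr (ae_of_all _ fun x => ?_)
    simp only
    rw [div_eq_mul_inv]
    ring
  · simp only [ContinuousLinearMap.mul_apply']
    exact h0'

/-! ### `ĵ ⟂ range Π_K` and `ĵ ⟂ e_K` -/

/-- **`ĵ ⟂ range Π_K`.** For every `f ∈ L²(μ_T)`: `∫ ĵ · (Π_K f) dμ_T = 0` — the redraw `Π_K f`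
and the junction force `V'(r_J)` do not depend on `p_{N−1}`, which enters `ĵ` linearly. -/
theorem floor_integral_jhat_mul_condK (hω : 0 < ω₂) (hl : 0 ≤ lam) (hb : 0 ≤ β) (γ : ℝ)
    (hN : 1 ≤ N) (hM : 1 ≤ M) {T : ℝ} (hT : 0 < T) {f : PhaseSpace (N + M) → ℝ}
    (hf : MemLp f 2 ((pinnedChain ω₂ lam β γ).gibbsMeasure (N + M) T)) :
    ∫ x, x.2 ⟨N - 1, by omega⟩ *
        ((x.1 ⟨N, by omega⟩ - x.1 ⟨N - 1, by omega⟩) +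
          β * (x.1 ⟨N, by omega⟩ - x.1 ⟨N - 1, by omega⟩) ^ 3) *
        condK T N M f x ∂((pinnedChain ω₂ lam β γ).gibbsMeasure (N + M) T) = 0 := by
  have hPi : MemLp (condK T N M f) 2 ((pinnedChain ω₂ lam β γ).gibbsMeasure (N + M) T) :=
    (memLp_condK_and_integral_sq_le hω hl hb γ (N + M) hT
      (fun i : Fin (N + M) => i.val = N - 1 ∨ i.val = N) hf).1
  have hVf := floor_memLp_junctionForce hω hl hb γ hN hM hT (M := M)
  have hJ := floor_memLp_jhat hω hl hb γ hN hM hT (M := M)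
  have hinv : ∀ (x : PhaseSpace (N + M)) (t : ℝ),
      (fun x : PhaseSpace (N + M) =>
          ((x.1 ⟨N, by omega⟩ - x.1 ⟨N - 1, by omega⟩) +
              β * (x.1 ⟨N, by omega⟩ - x.1 ⟨N - 1, by omega⟩) ^ 3) * condK T N M f x)
          (x + t • ((0, Pi.single ⟨N - 1, by omega⟩ 1) : PhaseSpace (N + M))) =
        (fun x : PhaseSpace (N + M) =>
          ((x.1 ⟨N, by omega⟩ - x.1 ⟨N - 1, by omega⟩) +
              β * (x.1 ⟨N, by omega⟩ - x.1 ⟨N - 1, by omega⟩) ^ 3) * condK T N M f x) x := by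
    intro x t
    simp only [add_smul_unitP_fst]
    congr 1
    exact condK_add_smul (N + M) (fun i : Fin (N + M) => i.val = N - 1 ∨ i.val = N) _ f x t
      (Or.inl rfl)
  have h0 : Integrable (fun x : PhaseSpace (N + M) =>
      ((x.1 ⟨N, by omega⟩ - x.1 ⟨N - 1, by omega⟩) +
          β * (x.1 ⟨N, by omega⟩ - x.1 ⟨N - 1, by omega⟩) ^ 3) * condK T N M f x)
      ((pinnedChain ω₂ lam β γ).gibbsMeasure (N + M) T) := hVf.integrable_mul hPi
  have h1 : Integrable (fun x : PhaseSpace (N + M) => x.2 ⟨N - 1, by omega⟩ *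
      (((x.1 ⟨N, by omega⟩ - x.1 ⟨N - 1, by omega⟩) +
          β * (x.1 ⟨N, by omega⟩ - x.1 ⟨N - 1, by omega⟩) ^ 3) * condK T N M f x))
      ((pinnedChain ω₂ lam β γ).gibbsMeasure (N + M) T) :=
    (hJ.integrable_mul hPi).congr (ae_of_all _ fun x => by simp only [Pi.mul_apply]; ring)
  have key := floor_integral_snd_mul_eq_zero hω hl hb γ (N + M) hT ⟨N - 1, by omega⟩ hinv h0 h1
  rw [← key]
  exact integral_congr_ae (ae_of_all _ fun x => by ring)

/-- **`ĵ ⟂ e_K`**: `ĵ e_K` is odd under the momentum reversal `p ↦ −p`, which preserves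
`e^{-H/T} dq dp`. -/
theorem floor_integral_jhat_mul_eK (ω₂ lam β γ T : ℝ) (hN : 1 ≤ N) (hM : 1 ≤ M) :
    ∫ x, x.2 ⟨N - 1, by omega⟩ *
        ((x.1 ⟨N, by omega⟩ - x.1 ⟨N - 1, by omega⟩) +
          β * (x.1 ⟨N, by omega⟩ - x.1 ⟨N - 1, by omega⟩) ^ 3) *
        eK T N M x ∂((pinnedChain ω₂ lam β γ).gibbsMeasure (N + M) T) = 0 := by
  rw [OscillatorChain.integral_gibbsMeasure]
  have h := integral_comp_momentumReversal (N + M) fun x : PhaseSpace (N + M) =>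
    x.2 ⟨N - 1, by omega⟩ *
        ((x.1 ⟨N, by omega⟩ - x.1 ⟨N - 1, by omega⟩) +
          β * (x.1 ⟨N, by omega⟩ - x.1 ⟨N - 1, by omega⟩) ^ 3) *
        eK T N M x * (pinnedChain ω₂ lam β γ).gibbsDensity (N + M) T x
  have heK : ∀ x : PhaseSpace (N + M), eK T N M (x.1, -x.2) = eK T N M x := by
    intro x
    simp only [eK, kin, Pi.neg_apply, neg_sq]
  have hρ : ∀ x : PhaseSpace (N + M), (pinnedChain ω₂ lam β γ).gibbsDensity (N + M) T (x.1, -x.2) =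
      (pinnedChain ω₂ lam β γ).gibbsDensity (N + M) T x := by
    intro x
    simp only [OscillatorChain.gibbsDensity, OscillatorChain.hamiltonian_neg_momentum]
  simp only [heK, hρ, Pi.neg_apply, neg_mul, integral_neg] at h
  have h0 : ∫ x : PhaseSpace (N + M), x.2 ⟨N - 1, by omega⟩ *
        ((x.1 ⟨N, by omega⟩ - x.1 ⟨N - 1, by omega⟩) +
          β * (x.1 ⟨N, by omega⟩ - x.1 ⟨N - 1, by omega⟩) ^ 3) *
        eK T N M x * (pinnedChain ω₂ lam β γ).gibbsDensity (N + M) T x = 0 := by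
    linarith
  rw [h0, mul_zero]


end Floor

/-! ### The registered helper -/

/-- **Helper `helper_roughnessFloor` (tightness, in order, of the lead's stub `stub_junctionRoughnessLTE`).**
For the plain `(N+M)`-chain's first-order NESS density `h` with Kubo conductance `G`
(`PlainFrame P T (N+M) h G`, `N, M ≥ 2`) and EVERY common probe temperature `θ`:
`G² ≤ (∫ ĵ² dμ_T) · v_K(h − θ e_K)`, `ĵ = p_{N−1} V'(q_N − q_{N−1})`, `V'(r) = r + βr³`.
Proof: `∫ ĵ h dμ_T = −G` (the weak equation tested against the left-block energy `H_N ∘ π_N`,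
`floor_junction_pairing`, and the Kubo link), `ĵ ⟂ e_K` (momentum reversal) and `ĵ ⟂ range Π_K`
(Gaussian integration by parts in `p_{N−1}`), so `−G = ∫ ĵ · (I − Π_K)(h − θe_K) dμ_T`; then
Cauchy–Schwarz. -/
theorem helper_roughnessFloor :
    ∀ (ω₂ lam β γ T : ℝ), 0 < ω₂ → 0 < lam → 0 < β → 0 < γ → 0 < T →
      ∀ (N M : ℕ) (hN : 2 ≤ N) (hM : 2 ≤ M) (h : PhaseSpace (N + M) → ℝ) (G : ℝ),
        PlainFrame (pinnedChain ω₂ lam β γ) T (N + M) h G →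
        ∀ θ : ℝ, G ^ 2 ≤
          (∫ x, (x.2 ⟨N - 1, by omega⟩ *
              ((x.1 ⟨N, by omega⟩ - x.1 ⟨N - 1, by omega⟩) +
                β * (x.1 ⟨N, by omega⟩ - x.1 ⟨N - 1, by omega⟩) ^ 3)) ^ 2
              ∂((pinnedChain ω₂ lam β γ).gibbsMeasure (N + M) T)) *
            roughness (pinnedChain ω₂ lam β γ) T N M (fun x => h x - θ * eK T N M x) := by
  intro ω₂ lam β γ T hω hlam hβ hγ hT N M hN hM h G hPF θ
  obtain ⟨⟨hhL2, -, hweak⟩, -, hG⟩ := hPF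
  have hl : 0 ≤ lam := hlam.le
  have hb : 0 ≤ β := hβ.le
  have hN1 : 1 ≤ N := by omega
  have hM1 : 1 ≤ M := by omega
  have hPγ : (pinnedChain ω₂ lam β γ).γ = γ := rfl
  haveI := pinnedChain_isProbabilityMeasure_gibbsMeasure hω hl hb γ (N + M) hT
  -- (1) the junction pairing `∫ ĵ h dμ_T = -G`
  have hpair := floor_junction_pairing hω hl hb γ hN hM hT hhL2 hweak
  rw [hPγ] at hG
  have hJh : ∫ x, x.2 ⟨N - 1, by omega⟩ *
      ((x.1 ⟨N, by omega⟩ - x.1 ⟨N - 1, by omega⟩) +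
        β * (x.1 ⟨N, by omega⟩ - x.1 ⟨N - 1, by omega⟩) ^ 3) * h x
      ∂((pinnedChain ω₂ lam β γ).gibbsMeasure (N + M) T) = -G := by
    rw [hpair, hG]
    ring
  -- (2) `f₀ = h − θ e_K`, its redraw, and the `L²` facts
  have hJ := floor_memLp_jhat hω hl hb γ hN1 hM1 hT (M := M)
  have heK : MemLp (eK T N M) 2 ((pinnedChain ω₂ lam β γ).gibbsMeasure (N + M) T) :=
    memLp_eK hω hl hb γ N M hT
  have hf₀ : MemLp (fun x => h x - θ * eK T N M x) 2 ((pinnedChain ω₂ lam β γ).gibbsMeasure (N + M) T) :=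
    hhL2.sub (heK.const_mul θ)
  have hPi : MemLp (condK T N M fun x => h x - θ * eK T N M x) 2
      ((pinnedChain ω₂ lam β γ).gibbsMeasure (N + M) T) :=
    (memLp_condK_and_integral_sq_le hω hl hb γ (N + M) hT
      (fun i : Fin (N + M) => i.val = N - 1 ∨ i.val = N) hf₀).1
  -- (3) `∫ ĵ f₀ dμ_T = -G` (`ĵ ⟂ e_K`)
  have hJe := floor_integral_jhat_mul_eK ω₂ lam β γ T hN1 hM1 (N := N) (M := M)
  have hJf : ∫ x, x.2 ⟨N - 1, by omega⟩ *
      ((x.1 ⟨N, by omega⟩ - x.1 ⟨N - 1, by omega⟩) +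
        β * (x.1 ⟨N, by omega⟩ - x.1 ⟨N - 1, by omega⟩) ^ 3) * (h x - θ * eK T N M x)
      ∂((pinnedChain ω₂ lam β γ).gibbsMeasure (N + M) T) = -G := by
    have i1 : Integrable (fun x : PhaseSpace (N + M) => x.2 ⟨N - 1, by omega⟩ *
        ((x.1 ⟨N, by omega⟩ - x.1 ⟨N - 1, by omega⟩) +
          β * (x.1 ⟨N, by omega⟩ - x.1 ⟨N - 1, by omega⟩) ^ 3) * h x)
        ((pinnedChain ω₂ lam β γ).gibbsMeasure (N + M) T) := hJ.integrable_mul hhL2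
    have i2 : Integrable (fun x : PhaseSpace (N + M) => x.2 ⟨N - 1, by omega⟩ *
        ((x.1 ⟨N, by omega⟩ - x.1 ⟨N - 1, by omega⟩) +
          β * (x.1 ⟨N, by omega⟩ - x.1 ⟨N - 1, by omega⟩) ^ 3) * eK T N M x)
        ((pinnedChain ω₂ lam β γ).gibbsMeasure (N + M) T) := hJ.integrable_mul heK
    have e : ∫ x, x.2 ⟨N - 1, by omega⟩ *
        ((x.1 ⟨N, by omega⟩ - x.1 ⟨N - 1, by omega⟩) +
          β * (x.1 ⟨N, by omega⟩ - x.1 ⟨N - 1, by omega⟩) ^ 3) * (h x - θ * eK T N M x)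
        ∂((pinnedChain ω₂ lam β γ).gibbsMeasure (N + M) T) =
        (∫ x, x.2 ⟨N - 1, by omega⟩ *
          ((x.1 ⟨N, by omega⟩ - x.1 ⟨N - 1, by omega⟩) +
            β * (x.1 ⟨N, by omega⟩ - x.1 ⟨N - 1, by omega⟩) ^ 3) * h x
          ∂((pinnedChain ω₂ lam β γ).gibbsMeasure (N + M) T)) -
        θ * ∫ x, x.2 ⟨N - 1, by omega⟩ *
          ((x.1 ⟨N, by omega⟩ - x.1 ⟨N - 1, by omega⟩) +
            β * (x.1 ⟨N, by omega⟩ - x.1 ⟨N - 1, by omega⟩) ^ 3) * eK T N M x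
          ∂((pinnedChain ω₂ lam β γ).gibbsMeasure (N + M) T) := by
      rw [← integral_const_mul, ← integral_sub i1 (i2.const_mul θ)]
      exact integral_congr_ae (ae_of_all _ fun x => by ring)
    rw [e, hJh, hJe]
    ring
  -- (4) remove the redraw: `∫ ĵ · (I − Π_K) f₀ dμ_T = -G` (`ĵ ⟂ range Π_K`)
  have hJPf := floor_integral_jhat_mul_condK hω hl hb γ hN1 hM1 hT hf₀
  have hfinal : ∫ x, x.2 ⟨N - 1, by omega⟩ *
      ((x.1 ⟨N, by omega⟩ - x.1 ⟨N - 1, by omega⟩) +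
        β * (x.1 ⟨N, by omega⟩ - x.1 ⟨N - 1, by omega⟩) ^ 3) *
      ((h x - θ * eK T N M x) - condK T N M (fun x => h x - θ * eK T N M x) x)
      ∂((pinnedChain ω₂ lam β γ).gibbsMeasure (N + M) T) = -G := by
    have i1 : Integrable (fun x : PhaseSpace (N + M) => x.2 ⟨N - 1, by omega⟩ *
        ((x.1 ⟨N, by omega⟩ - x.1 ⟨N - 1, by omega⟩) +
          β * (x.1 ⟨N, by omega⟩ - x.1 ⟨N - 1, by omega⟩) ^ 3) * (h x - θ * eK T N M x))
        ((pinnedChain ω₂ lam β γ).gibbsMeasure (N + M) T) := hJ.integrable_mul hf₀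
    have i2 : Integrable (fun x : PhaseSpace (N + M) => x.2 ⟨N - 1, by omega⟩ *
        ((x.1 ⟨N, by omega⟩ - x.1 ⟨N - 1, by omega⟩) +
          β * (x.1 ⟨N, by omega⟩ - x.1 ⟨N - 1, by omega⟩) ^ 3) *
        condK T N M (fun x => h x - θ * eK T N M x) x)
        ((pinnedChain ω₂ lam β γ).gibbsMeasure (N + M) T) := hJ.integrable_mul hPi
    have e := integral_sub i1 i2
    rw [hJf, hJPf, sub_zero] at e
    rw [← e]
    exact integral_congr_ae (ae_of_all _ fun x => by ring)
  -- (5) Cauchy–Schwarz against `(I − Π_K) f₀`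
  have hcs := sq_integral_mul_le hJ (hf₀.sub hPi)
  calc G ^ 2 = (∫ x, x.2 ⟨N - 1, by omega⟩ *
        ((x.1 ⟨N, by omega⟩ - x.1 ⟨N - 1, by omega⟩) +
          β * (x.1 ⟨N, by omega⟩ - x.1 ⟨N - 1, by omega⟩) ^ 3) *
        ((h x - θ * eK T N M x) - condK T N M (fun x => h x - θ * eK T N M x) x)
        ∂((pinnedChain ω₂ lam β γ).gibbsMeasure (N + M) T)) ^ 2 := by rw [hfinal]; ring
    _ ≤ _ := hcs

end Summit.AtomisticToContinuum.FouriersLaw.Cruxes.SuperadditiveResistance.ThermaliseThenCutProbeInsertion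

end
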